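import Literature.AlgebraicGeometry.Motives.HodgeLieWeightOneSl2CenterSplitting
import HarnessLib

/-!
# Weight-one Hodge structures whose Hodge Lie algebra has a three-dimensional derived algebra and ARBITRARY centre.
# D: the centre of `Lie Hg` kills the `𝔰𝔩₂`-part — `Z p = 0` and `Z D = 0` for `Z ∈ 𝔷`, `D ∈ 𝔡`

Family `hodge`, layer `Literature/AlgebraicGeometry/Motives`; THEOREMS ONLY (no definition, no named fact; D-0026).
Fourth abstract file of the lane MT-RANK-SIX-ISOGENY of the cell `pub-hodgecm2` (COR-CM), seat `b27` (setting as in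
`Motives/HodgeLieWeightOneSl2Center{,Commutator,Splitting}`: polarizable weight-one `H`, polarization `ψ`, graded basis
`e` with degrees in `{0,1}`, `P = gradingEnd e deg`, `X ∈ 𝔥 ∖ End_Hdg(V)`, `E = P X_ℂ (1 − P)`, `F = (1 − P) X_ℂ P`, centre
`𝔷 = 𝔥 ∩ End_Hdg(V)`, derived algebra `𝔡` of dimension `3`, `[E, F] = α(2P−1) + ζ₀`, the projector
`π = α⁻¹(EF + FE) = p_ℂ` with `p` the rational idempotent of `exists_rat_projector`).

* §6 `center_mul_projector_eq_zero` — **`Z p = 0` for every `Z ∈ 𝔷`.**  PROOF (the `β ≠ 0` argument of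
  `Motives/HodgeLieWeightOneRankFourSplitting`, run on the corner at `π`): a `ℂ`-linear `T` commuting with `P, E, F`
  commutes with the rational brackets (`𝔡_ℂ = ℂE ⊕ ℂF ⊕ ℂ[E,F]`), so by commutant descent
  (`mem_span_baseChange_of_forall_commute`) it is a combination of `b_ℂ` with `b` rational commuting with `𝔡`; for such `b`,
  `α[b, 2P−1]π = [ζ₀, b]π = 0` (`ζ₀π = 0 = πζ₀`, `bπ = πb`), so `b p` is a RATIONAL endomorphism whose complexification
  commutes with `P`, i.e. a Hodge endomorphism, which commutes with `Z ∈ 𝔥`; hence `Z_ℂ π` is central in the corner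
  `{T | [T,P] = [T,E] = [T,F] = 0, Tπ = T = πT}`, so `Z_ℂ π = c π` (`SL2Triple.exists_eq_smul_of_mem_center_corner_commutant`,
  `P π ≠ 0` as `E F E = αE ≠ 0`), `c ∈ ℚ` (`exists_ratCast_eq_of_baseChange_eq_smul`), and `c = 0` because `Z` is `ψ`-skew,
  `p` is `ψ`-symmetric, `Z p = p Z` and `ψ` is non-degenerate.
* `center_mul_derived_eq_zero` — **`Z D = 0` for all `Z ∈ 𝔷 = 𝔥 ∩ End_Hdg(V)` and `D ∈ 𝔡 = [𝔥, 𝔥]`**, basis-free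
  (weight `1`, effective, polarizable, `𝔥 ⊄ End_Hdg(V)`, `dim_ℚ 𝔡 = 3`): `D = p D`.

Classically (Moonen–Zarhin 1999 §2; Deligne, LNM 900, I §3): `Hg⁰ = SL₂ · Z⁰`, and the central torus acts trivially on
the part of `V` where `SL₂` acts non-trivially.  The sequel reads the resulting splitting `V = pV ⊕ (1 − p)V` on
`End_Hdg(V)`.

## References

* [MoonenZarhin1999LowDim] B. Moonen, Yu. Zarhin, *Hodge classes on abelian varieties of low dimension*, Math. Ann. 315
  (1999), §2.
* [Deligne1982HodgeCycles] P. Deligne, *Hodge cycles on abelian varieties*, LNM 900 (1982), I §3 (3.1–3.7).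
* [Zarhin1983HodgeGroupsK3] Yu. G. Zarhin, *Hodge groups of K3 surfaces*, J. reine angew. Math. 341 (1983), §2.
* [FultonHarris1991] W. Fulton, J. Harris, *Representation Theory*, GTM 129 (1991), Lecture 11 (§11.1).
* [Huybrechts2016K3] D. Huybrechts, *Lectures on K3 Surfaces* (2016), Thm. 3.3.9 (proof, p. 67).
-/

noncomputable section

open scoped TensorProduct

namespace Literature.AlgebraicGeometry.Motives

universe u

namespace HodgeStructure

open ProjectorBlocks Literature.RepresentationTheory.GeneralLinear

variable {V : Type u} [AddCommGroup V] [Module ℚ V] [Module.Finite ℚ V] [HodgeTensorFacts.{u, u}] {n : ℤ}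
  {S : Type u} [Fintype S] [DecidableEq S] {deg : S → ℤ}

/-! ## §6 The centre kills the `𝔰𝔩₂`-part -/

/-- **`Z p = 0` for every `Z ∈ 𝔷 = 𝔥 ∩ End_Hdg(V)`**, where `p` is the rational idempotent with `p_ℂ = π = α⁻¹(EF + FE)`
(`exists_rat_projector`; hypotheses: `p_ℂ = π`, `p ≠ 0`, `p` `ψ`-symmetric).  See the module docstring for the proof
(commutant descent on the corner at `π`, `SL2Triple.exists_eq_smul_of_mem_center_corner_commutant`, rationality of the
scalar, and `ψ`-skewness of `Z`). [cite: MoonenZarhin1999LowDim, §2] [cite: Zarhin1983HodgeGroupsK3, §2]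
[cite: Deligne1982HodgeCycles, I §3 (3.1–3.7)] [cite: FultonHarris1991, Lecture 11 (§11.1)] -/
theorem center_mul_projector_eq_zero (H : HodgeStructure V n) (ψ : H.Polarization) (hn : n = 1)
    (e : Module.Basis S ℂ (ℂ ⊗[ℚ] V)) (hF : ∀ a, H.F a = Submodule.span ℂ (e '' {σ | a ≤ deg σ}))
    (hFc : ∀ a, complexConj (H.F a) = Submodule.span ℂ (e '' {σ | deg σ ≤ n - a}))
    (hdeg : ∀ σ, deg σ = 0 ∨ deg σ = 1) {X : Module.End ℚ V} (hX : X ∈ H.hodgeLie) (hXE : X ∉ H.endAlg)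
    (h3 : Module.finrank ℚ ↥(Submodule.span ℚ {B | ∃ X ∈ H.hodgeLie, ∃ Y ∈ H.hodgeLie, X * Y - Y * X = B}) = 3)
    {α : ℂ} (hα : α ≠ 0) {ζ₀ : Module.End ℂ (ℂ ⊗[ℚ] V)}
    (hζ₀ : ζ₀ ∈ spanC (H.hodgeLie ⊓ Subalgebra.toSubmodule H.endAlg))
    (hEF : (gradingEnd e deg * X.baseChange ℂ * (1 - gradingEnd e deg)) *
          ((1 - gradingEnd e deg) * X.baseChange ℂ * gradingEnd e deg) -
        ((1 - gradingEnd e deg) * X.baseChange ℂ * gradingEnd e deg) *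
          (gradingEnd e deg * X.baseChange ℂ * (1 - gradingEnd e deg)) =
        α • ((2 : ℂ) • gradingEnd e deg - 1) + ζ₀)
    {Q : Module.End ℂ (ℂ ⊗[ℚ] V)}
    (hQ : Q = α⁻¹ • ((gradingEnd e deg * X.baseChange ℂ * (1 - gradingEnd e deg)) *
          ((1 - gradingEnd e deg) * X.baseChange ℂ * gradingEnd e deg) +
        ((1 - gradingEnd e deg) * X.baseChange ℂ * gradingEnd e deg) *
          (gradingEnd e deg * X.baseChange ℂ * (1 - gradingEnd e deg))))
    {p : Module.End ℚ V} (hpQ : p.baseChange ℂ = Q) (hp0 : p ≠ 0) (hpsymm : ∀ v w, ψ.form (p v) w = ψ.form v (p w))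
    {Z : Module.End ℚ V} (hZ : Z ∈ H.hodgeLie) (hZA : Z ∈ H.endAlg) : Z * p = 0 := by
  classical
  subst hn
  set 𝔡 := Submodule.span ℚ {B | ∃ X ∈ H.hodgeLie, ∃ Y ∈ H.hodgeLie, X * Y - Y * X = B} with h𝔡
  set 𝔷 := H.hodgeLie ⊓ Subalgebra.toSubmodule H.endAlg with h𝔷
  obtain ⟨hEFE, -, hQQ, hPQ, hEQ', hQE, hFQ', hQF', hEF', hFE', -, hζQ, hQζ⟩ :=
    projector_identities H rfl e hF hFc hdeg hX hα hζ₀ hEF hQ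
  obtain ⟨hE0, -⟩ := projE_ne_zero_of_not_mem_endAlg H rfl e hF hFc hdeg hXE
  set P := gradingEnd e deg with hP
  set Y := X.baseChange ℂ with hY
  set E := P * Y * (1 - P) with hEdef
  set F := (1 - P) * Y * P with hFdef
  have hPP : P * P = P := gradingEnd_mul_gradingEnd_of_deg e hdeg
  have hPE : P * E = E := by rw [hEdef, ← mul_assoc, ← mul_assoc, hPP]
  have hEP : E * P = 0 := by rw [hEdef, mul_assoc (P * Y) (1 - P) P, sub_mul, one_mul, hPP, sub_self, mul_zero]
  have hPF : P * F = 0 := by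
    rw [hFdef, mul_assoc (1 - P) Y P, ← mul_assoc P (1 - P) (Y * P), mul_sub, mul_one, hPP, sub_self, zero_mul]
  have hFP : F * P = F := by rw [hFdef, mul_assoc ((1 - P) * Y) P P, hPP]
  have hYM : Y ∈ H.hodgeLieC := H.baseChange_mem_hodgeLieC hX
  obtain ⟨hEM, hFM⟩ := projE_mem_hodgeLieC H e hF hFc hdeg hYM
  rw [← hP, ← hEdef] at hEM
  rw [← hP, ← hFdef] at hFM
  have hΘ' : (2 : ℂ) • P - 1 ∈ H.hodgeLieC := by
    simpa only [Int.cast_one, one_smul] using two_smul_gradingEnd_sub_mem_hodgeLieC H e hF hFc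
  have h𝔡le : 𝔡 ≤ H.hodgeLie := by
    refine Submodule.span_le.2 ?_
    rintro _ ⟨X₁, hX₁, X₂, hX₂, rfl⟩
    exact H.commutator_mem_hodgeLie hX₁ hX₂
  -- `Φ = Z_ℂ` commutes with `P, E, F, Q`
  set Φ := Z.baseChange ℂ with hΦdef
  have hZ𝔷 : Z ∈ 𝔷 := Submodule.mem_inf.2 ⟨hZ, hZA⟩
  have hΦ𝔷 : Φ ∈ spanC 𝔷 := baseChange_mem_spanC hZ𝔷
  have hΦP : Φ * P = P * Φ := commute_gradingEnd_of_mem_spanC_center H rfl e hF hFc hΦ𝔷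
  have hΦE : Φ * E = E * Φ := commute_of_mem_spanC_center H hΦ𝔷 hEM
  have hΦF : Φ * F = F * Φ := commute_of_mem_spanC_center H hΦ𝔷 hFM
  have hΦQ : Φ * Q = Q * Φ := by
    rw [hQ, mul_smul_comm, smul_mul_assoc, mul_add, add_mul, ← mul_assoc Φ E F, hΦE, mul_assoc E Φ F, hΦF,
      ← mul_assoc E F Φ, ← mul_assoc Φ F E, hΦF, mul_assoc F Φ E, hΦE, ← mul_assoc F E Φ]
  -- the commutant of `{P, E, F}` and its corner at `Q`
  set C : Submodule ℂ (Module.End ℂ (ℂ ⊗[ℚ] V)) :=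
    LinearMap.ker (LinearMap.mulRight ℂ P - LinearMap.mulLeft ℂ P) ⊓
      LinearMap.ker (LinearMap.mulRight ℂ E - LinearMap.mulLeft ℂ E) ⊓
      LinearMap.ker (LinearMap.mulRight ℂ F - LinearMap.mulLeft ℂ F) with hCdef
  have hC : ∀ T, T ∈ C ↔ T * P = P * T ∧ T * E = E * T ∧ T * F = F * T := by
    intro T
    simp only [hCdef, Submodule.mem_inf, LinearMap.mem_ker, LinearMap.sub_apply, LinearMap.mulRight_apply,
      LinearMap.mulLeft_apply, sub_eq_zero, and_assoc]
  set Dc : Submodule ℂ (Module.End ℂ (ℂ ⊗[ℚ] V)) :=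
    C ⊓ LinearMap.ker (LinearMap.mulRight ℂ Q - LinearMap.id) ⊓ LinearMap.ker (LinearMap.mulLeft ℂ Q - LinearMap.id)
    with hDcdef
  have hDc : ∀ T, T ∈ Dc ↔ T ∈ C ∧ T * Q = T ∧ Q * T = T := by
    intro T
    simp only [hDcdef, Submodule.mem_inf, LinearMap.mem_ker, LinearMap.sub_apply, LinearMap.mulRight_apply,
      LinearMap.mulLeft_apply, LinearMap.id_coe, id_eq, sub_eq_zero, and_assoc]
  -- rational brackets and their commutant: for `b` commuting with `𝔡`, `(b_ℂ Q)` commutes with `Φ`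
  set brk : Set (Module.End ℚ V) := (fun q : Module.End ℚ V × Module.End ℚ V => q.1 * q.2 - q.2 * q.1) ''
    ((H.hodgeLie : Set (Module.End ℚ V)) ×ˢ (H.hodgeLie : Set (Module.End ℚ V))) with hbrk
  have hbrk𝔡 : ∀ s ∈ brk, s ∈ 𝔡 := by
    rintro _ ⟨⟨X₁, X₂⟩, ⟨hX₁, hX₂⟩, rfl⟩
    exact Submodule.subset_span ⟨X₁, hX₁, X₂, hX₂, rfl⟩
  have hb : ∀ b : Module.End ℚ V, (∀ s ∈ brk, b * s = s * b) → b.baseChange ℂ * Q * Φ = Φ * (b.baseChange ℂ * Q) := by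
    intro b hb
    -- `b` commutes with `𝔡`, hence `b_ℂ` with `𝔡_ℂ ∋ E, F, [E,F]` and with `Q`
    have hb𝔡 : ∀ D ∈ 𝔡, b * D = D * b := by
      intro D hD
      induction hD using Submodule.span_induction with
      | mem s hs =>
        obtain ⟨X₁, hX₁, X₂, hX₂, rfl⟩ := hs
        exact hb _ ⟨(X₁, X₂), ⟨hX₁, hX₂⟩, rfl⟩
      | zero => rw [mul_zero, zero_mul]
      | add x y _ _ hx hy => rw [mul_add, add_mul, hx, hy]
      | smul c x _ hx => rw [mul_smul_comm, smul_mul_assoc, hx]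
    have hbC : ∀ D ∈ spanC 𝔡, b.baseChange ℂ * D = D * b.baseChange ℂ := by
      intro D hD
      unfold spanC at hD
      induction hD using Submodule.span_induction with
      | mem D' hD' =>
        obtain ⟨D₀, hD₀, rfl⟩ := hD'
        rw [← LinearMap.baseChange_mul, hb𝔡 D₀ hD₀, LinearMap.baseChange_mul]
      | zero => rw [mul_zero, zero_mul]
      | add x y _ _ hx hy => rw [mul_add, add_mul, hx, hy]
      | smul c x _ hx => rw [mul_smul_comm, smul_mul_assoc, hx]
    obtain ⟨hEd, hFd⟩ := projE_mem_spanC_derived H rfl e hF hFc hdeg hX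
    rw [← hP, ← hY, ← hEdef] at hEd
    rw [← hP, ← hY, ← hFdef] at hFd
    have hbE : b.baseChange ℂ * E = E * b.baseChange ℂ := hbC E hEd
    have hbF : b.baseChange ℂ * F = F * b.baseChange ℂ := hbC F hFd
    have hbB : b.baseChange ℂ * (E * F - F * E) = (E * F - F * E) * b.baseChange ℂ :=
      hbC _ (bracket_mem_spanC_derived H hEM hFM)
    have hbQ : b.baseChange ℂ * Q = Q * b.baseChange ℂ := by
      rw [hQ, mul_smul_comm, smul_mul_assoc, mul_add, add_mul, ← mul_assoc _ E F, hbE, mul_assoc E _ F, hbF,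
        ← mul_assoc E F _, ← mul_assoc _ F E, hbF, mul_assoc F _ E, hbE, ← mul_assoc F E _]
    -- `α [b, 2P−1] Q = [ζ₀, b] Q = 0`, so `b_ℂ Q` commutes with `2P − 1`
    set β := b.baseChange ℂ with hβ
    have hbr : α • (β * ((2 : ℂ) • P - 1) - ((2 : ℂ) • P - 1) * β) = ζ₀ * β - β * ζ₀ := by
      have h := hbB
      rw [hEF, mul_add, add_mul, mul_smul_comm, smul_mul_assoc] at h
      -- `h : α • (β Θ') + β ζ₀ = α • (Θ' β) + ζ₀ β`
      rw [smul_sub]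
      have h' := sub_eq_zero.2 h
      apply eq_of_sub_eq_zero
      rw [← sub_eq_zero.1 (show α • (β * ((2 : ℂ) • P - 1)) + β * ζ₀ - (α • (((2 : ℂ) • P - 1) * β) + ζ₀ * β) -
        (α • (β * ((2 : ℂ) • P - 1)) - α • (((2 : ℂ) • P - 1) * β) - (ζ₀ * β - β * ζ₀)) = 0 by abel)]
      exact h'
    have hbrQ : (β * ((2 : ℂ) • P - 1) - ((2 : ℂ) • P - 1) * β) * Q = 0 := by
      have h : (α • (β * ((2 : ℂ) • P - 1) - ((2 : ℂ) • P - 1) * β)) * Q = 0 := by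
        rw [hbr, sub_mul, mul_assoc ζ₀ β Q, hbQ, ← mul_assoc ζ₀ Q β, hζQ, zero_mul, mul_assoc β ζ₀ Q, hζQ, mul_zero,
          sub_zero]
      rw [smul_mul_assoc] at h
      exact (smul_eq_zero.1 h).resolve_left hα
    have hQΘ : Q * ((2 : ℂ) • P - 1) = ((2 : ℂ) • P - 1) * Q := by
      rw [mul_sub, sub_mul, mul_smul_comm, smul_mul_assoc, ← hPQ, mul_one, one_mul]
    have hb'Θ : (β * Q) * ((2 : ℂ) • P - 1) = ((2 : ℂ) • P - 1) * (β * Q) := by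
      rw [mul_assoc β Q _, hQΘ, ← mul_assoc β _ Q]
      have h := hbrQ
      rw [sub_mul, sub_eq_zero] at h
      rw [h, mul_assoc]
    have hb'P : (β * Q) * P = P * (β * Q) := by
      rw [mul_sub (β * Q) _ 1, sub_mul _ 1 (β * Q), mul_one, one_mul, mul_smul_comm, smul_mul_assoc, sub_left_inj] at hb'Θ
      exact smul_right_injective _ (two_ne_zero' ℂ) hb'Θ
    -- `b p` is a rational Hodge endomorphism, hence commutes with `Z`
    have hbpC : (b * p).baseChange ℂ = β * Q := by rw [LinearMap.baseChange_mul, hpQ]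
    have hbpA : b * p ∈ H.endAlg := by
      have hc : (b * p).baseChange ℂ * P = P * (b * p).baseChange ℂ := by rw [hbpC, hb'P]
      exact mem_endAlg_of_projE_eq_zero H e hF hdeg (blocks_D hPP hc).1 (blocks_D hPP hc).2
    have hZbp : Z * (b * p) = (b * p) * Z := commute_of_mem_hodgeLie H hZ ⟨b * p, hbpA⟩
    have h1 : (Z * (b * p)).baseChange ℂ = Φ * (β * Q) := by rw [LinearMap.baseChange_mul, hbpC]
    have h2 : (b * p * Z).baseChange ℂ = (β * Q) * Φ := by rw [LinearMap.baseChange_mul, hbpC]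
    rw [hZbp] at h1
    exact (h1.symm.trans h2).symm
  -- every element of the corner commutes with `Φ`
  have hkey : ∀ T ∈ Dc, T * Φ = Φ * T := by
    intro T hT
    obtain ⟨hTC, hTQ, -⟩ := (hDc T).1 hT
    obtain ⟨hTP, hTE, hTF⟩ := (hC T).1 hTC
    have hTB : T * (E * F - F * E) = (E * F - F * E) * T := by
      rw [mul_sub, sub_mul, ← mul_assoc T E F, hTE, mul_assoc E T F, hTF, ← mul_assoc E F T, ← mul_assoc T F E, hTF,
        mul_assoc F T E, hTE, ← mul_assoc F E T]
    have hTs : ∀ s ∈ brk, T * s.baseChange ℂ = s.baseChange ℂ * T := by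
      intro s hs
      obtain ⟨c, hc⟩ := exists_coeffs_of_mem_spanC_derived H ψ rfl e hF hFc hdeg hX hXE h3
        (baseChange_mem_spanC (hbrk𝔡 s hs))
      rw [← hP, ← hY, ← hEdef, ← hFdef] at hc
      rw [hc]
      simp only [mul_add, add_mul, mul_smul_comm, smul_mul_assoc, hTE, hTF, hTB]
    have hTmem := mem_span_baseChange_of_forall_commute brk hTs
    have hTQΦ : T * Q * Φ = Φ * (T * Q) := by
      refine Submodule.span_induction (p := fun T _ => T * Q * Φ = Φ * (T * Q)) ?_ ?_ ?_ ?_ hTmem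
      · rintro _ ⟨b, hb', rfl⟩
        exact hb b hb'
      · rw [zero_mul, zero_mul, mul_zero]
      · intro x y _ _ hx hy; rw [add_mul, add_mul, mul_add, hx, hy]
      · intro c x _ hx; rw [smul_mul_assoc, smul_mul_assoc, mul_smul_comm, hx]
    rw [hTQ] at hTQΦ
    exact hTQΦ
  -- `Φ Q` lies in the corner and is central there
  have hΦC : Φ ∈ C := (hC Φ).2 ⟨hΦP, hΦE, hΦF⟩
  have hΦQD : Φ * Q ∈ Dc := by
    rw [hDc, hC]
    refine ⟨⟨?_, ?_, ?_⟩, ?_, ?_⟩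
    · rw [mul_assoc Φ Q P, ← hPQ, ← mul_assoc Φ P Q, hΦP, mul_assoc]
    · rw [mul_assoc Φ Q E, hQE, ← mul_assoc E Φ Q, ← hΦE, mul_assoc Φ E Q, hEQ']
    · rw [mul_assoc Φ Q F, hQF', ← mul_assoc F Φ Q, ← hΦF, mul_assoc Φ F Q, hFQ']
    · rw [mul_assoc Φ Q Q, hQQ]
    · rw [← mul_assoc Q Φ Q, ← hΦQ, mul_assoc Φ Q Q, hQQ]
  have hcen : ∀ T' ∈ Dc, Φ * Q * T' = T' * (Φ * Q) := by
    intro T' hT'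
    obtain ⟨-, hT'Q, hQT'⟩ := (hDc T').1 hT'
    rw [mul_assoc Φ Q T', hQT', ← mul_assoc T' Φ Q, hkey T' hT', mul_assoc Φ T' Q, hT'Q]
  -- `P Q ≠ 0`
  have hPQ0 : P * Q ≠ 0 := by
    intro h0
    apply hE0
    have h1 : E * F = 0 := by rw [hEF', h0, smul_zero]
    have h2 : α • E = 0 := by rw [← hEFE, h1, zero_mul]
    exact (smul_eq_zero.1 h2).resolve_left hα
  obtain ⟨c, hc⟩ := SL2Triple.exists_eq_smul_of_mem_center_corner_commutant hα hQQ hPQ hPP hPE hEP hPF hFP hEQ' hQE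
    hFQ' hQF' hEF' hFE' hPQ0 hC hDc hΦQD hcen
  -- `c` is rational: `(Z p)_ℂ = c • p_ℂ`
  have hZpC : (Z * p).baseChange ℂ = c • p.baseChange ℂ := by rw [LinearMap.baseChange_mul, hpQ, ← hΦdef, hc]
  obtain ⟨q, hq⟩ := exists_ratCast_eq_of_baseChange_eq_smul hp0 hZpC
  have hZp : Z * p = q • p := by
    apply sub_eq_zero.1
    apply eq_zero_of_baseChange_eq_zero
    rw [LinearMap.baseChange_sub, hZpC, baseChange_ratCast_smul, hq, sub_self]
  -- `q = 0`: `Z` is `ψ`-skew, `p` is `ψ`-symmetric, `Z p = p Z`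
  have hpZ : Z * p = p * Z := by
    -- `p_ℂ = Q` commutes with `Φ`
    apply eq_of_sub_eq_zero
    apply eq_zero_of_baseChange_eq_zero
    rw [LinearMap.baseChange_sub, LinearMap.baseChange_mul, LinearMap.baseChange_mul, hpQ, ← hΦdef, hΦQ, sub_self]
  have hZskew : ∀ v w, ψ.form (Z v) w + ψ.form v (Z w) = 0 := fun v w => form_apply_add_eq_zero_of_mem_hodgeLie ψ hZ v w
  by_contra hne
  have hq0 : q ≠ 0 := by
    rintro rfl
    exact hne (by rw [hZp, zero_smul])
  apply hp0
  refine LinearMap.ext fun v => ?_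
  rw [LinearMap.zero_apply]
  refine ψ.nondegenerate.1 (p v) fun w => ?_
  have h1 : ψ.form ((Z * p) v) w = q * ψ.form (p v) w := by
    rw [hZp, LinearMap.smul_apply, LinearMap.map_smul₂, smul_eq_mul]
  have h2 : ψ.form ((Z * p) v) w = -(q * ψ.form (p v) w) := by
    have ha := hZskew (p v) w
    rw [Module.End.mul_apply]
    have hb : ψ.form (p v) (Z w) = ψ.form v (p (Z w)) := hpsymm v (Z w)
    have hc' : p (Z w) = (Z * p) w := by rw [hpZ, Module.End.mul_apply]
    rw [hc', hZp, LinearMap.smul_apply, map_smul, smul_eq_mul, ← hpsymm] at hb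
    linarith
  have h3' : (2 * q) * ψ.form (p v) w = 0 := by linarith
  rcases mul_eq_zero.1 h3' with h | h
  · exact absurd h (mul_ne_zero two_ne_zero hq0)
  · exact h

/-- **The centre of `Lie Hg` kills its derived algebra: `Z D = 0` for `Z ∈ 𝔷 = 𝔥 ∩ End_Hdg(V)` and
`D ∈ 𝔡 = span_ℚ {[X₁, X₂]}`** — basis-free form, for a polarizable effective weight-one `H` with `𝔥 ⊄ End_Hdg(V)` and
`dim_ℚ 𝔡 = 3`: `D = p D` (`exists_rat_projector`) and `Z p = 0` (`center_mul_projector_eq_zero`).  So `V = pV ⊕ (1−p)V`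
with `𝔡` acting only on `pV` and `𝔷` only on `(1−p)V` (Moonen–Zarhin: `Hg⁰ = SL₂ × Z⁰` acting factorwise).
[cite: MoonenZarhin1999LowDim, §2] [cite: Deligne1982HodgeCycles, I §3 (3.1–3.7)] -/
theorem center_mul_derived_eq_zero (H : HodgeStructure V n) (ψ : H.Polarization) (hn : n = 1) (heff : H.IsEffective)
    (hne : ¬ H.hodgeLie ≤ Subalgebra.toSubmodule H.endAlg)
    (h3 : Module.finrank ℚ ↥(Submodule.span ℚ {B | ∃ X ∈ H.hodgeLie, ∃ Y ∈ H.hodgeLie, X * Y - Y * X = B}) = 3)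
    {Z : Module.End ℚ V} (hZ : Z ∈ H.hodgeLie ⊓ Subalgebra.toSubmodule H.endAlg) {D : Module.End ℚ V}
    (hD : D ∈ Submodule.span ℚ {B | ∃ X ∈ H.hodgeLie, ∃ Y ∈ H.hodgeLie, X * Y - Y * X = B}) : Z * D = 0 := by
  classical
  obtain ⟨X, hX, hXE⟩ := SetLike.not_le_iff_exists.1 hne
  rw [Subalgebra.mem_toSubmodule] at hXE
  obtain ⟨S, deg, e, hF, hFc⟩ := exists_basis_F_eq_span H
  haveI : Fintype S := FiniteDimensional.fintypeBasisIndex e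
  have hdeg : ∀ σ, deg σ = 0 ∨ deg σ = 1 := fun σ => by
    have h := heff.deg_mem_Icc_of_graded e hF hFc σ
    omega
  subst hn
  obtain ⟨α, ζ₀, hα, hζ₀, hEF⟩ := exists_commutator_eq_of_finrank_derived_eq_three H ψ rfl heff e hF hFc hdeg hX hXE h3
  obtain ⟨p, hpQ, -, hp0, -, -, -, -, hDp, hpsymm⟩ :=
    exists_rat_projector H ψ rfl heff e hF hFc hdeg hX hXE h3 hα hζ₀ hEF rfl
  have hZp := center_mul_projector_eq_zero H ψ rfl e hF hFc hdeg hX hXE h3 hα hζ₀ hEF rfl hpQ hp0 hpsymm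
    (Submodule.mem_inf.1 hZ).1 (Submodule.mem_inf.1 hZ).2
  rw [← (hDp D hD).2, ← mul_assoc, hZp, zero_mul]

end HodgeStructure

end Literature.AlgebraicGeometry.Motives

end
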